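import Mathlib
import Literature.NumberTheory.LFunctions.Zhang2022.Section14GaussSums
import HarnessLib

/-!
# Zhang (2022) §14 u017: the left side of (14.8) re-indexed by conductor — `lhs148 ≪ rhs1417`
# on the CLOSED conductor range `1 < r ≤ 2DP₄`, kernel-checked

Topic `Literature/NumberTheory/LFunctions/Zhang2022` (Landau–Siegel audit tree; verdict-neutral).
Y. Zhang, *Discrete mean estimates and the Landau–Siegel zero*, arXiv:2211.02515v1 (2022)
[Zhang2022LandauSiegel], §14 p. 79 (tex L3950–L3963) — **an unrefereed manuscript under adjudication**;
nothing here asserts or denies its Theorems 1–2, and nothing here is about Landau–Siegel zeros.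
ZHANG-L discharge lane (WP14, seat zl-w14-p2).

The printed step u017 (p. 79): "If `θ (mod Dk)` is induced by a primitive character `θ* (mod r)`, then
`r ∣ Dk` and `|τ(θ̄)| ≤ √r` … Thus, substituting `Dk = hr`, we see that the left side of (14.8) is
`≪ Σ_d d⁻¹ Σ_{1<r<2DP₄} Σ_{h<P/r, h≡0 (D/(D,r))} D/(φ(hr)h√r) Σ*_{θ (mod r), θ≠χ} |Σ_{(l,h)=1} κ*(dl)θ(l)
Σ_{p∼P} χθ̄(p)Δ(l/(phr))|`". This file PROVES that re-indexing, with the implied constant equal to the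
constant `B` of (14.2) (`|a*(dk)| ≤ B`), for every large `D`:

* `lhs148_le_rhs1417On_closed` — `lhs148 χ 𝐤* 𝐚* ≤ B · rhs1417On χ 𝐤* [2, ⌊2DP₄⌋]`, i.e. u017 with the
  conductor range CLOSED at the right end (`1 < r ≤ 2DP₄`);
* `step14u017_closed` — the same in the `∃ C, ForAllLarge (A → …)` shape of `Typed.Sec14.Step14u017`;
* `eq148_of_legs_closed` — the consumer edge: (14.8) (`Typed.Sec14.Eq148`) follows from the first
  `r`-range estimate as typed (`Typed.Sec14.Eq148leg1`, `1 < r < D³`) and the second `r`-range estimate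
  on the closed range `D³ ≤ r ≤ 2DP₄` (stated inline), so that no consumer needs the open-range u017.

WHY THE CLOSED RANGE (boundary remark, recorded for the WP14 plan): the typed `Typed.Sec14.lhs148` sums
`k ∈ [1, ⌊2P₄⌋]`, while the typed `Typed.Sec14.rhs1417` sums `r ∈ [2, ⌈2DP₄⌉)` (the printed strict
`r < 2DP₄`). Every term of the left side maps injectively to the right by `θ ↦ (r, h, θ*) =
(conductor θ, Dk/r, primitive character of θ)` EXCEPT, when `2P₄` happens to be an integer, the terms with
`k = 2P₄`, `θ` primitive mod `Dk` (`r = Dk = 2DP₄`, `h = 1`), which the strict range omits; excluding that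
event would require `2·P₄(D) = 2exp(𝓛⁹ − 2𝓛^{1.1})𝓛⁵¹⁹ ∉ ℕ`, a transcendence statement nobody needs. With
the range closed at `⌊2DP₄⌋` the re-indexing is exact bookkeeping: `|τ(θ̄)| ≤ √r` (`step14p79_holds`),
`D/(D,r) ∣ h` (u016, `step14u016_holds`), `θ(l) = θ*(l)·[(l,h) = 1]`, `θ̄(p) = θ̄*(p)` for `p ∼ P`
(`p > P > 2DP₄ ≥ Dk`), and `|a*(dk)|·√r/(φ(Dk)k) ≤ B·D/(φ(hr)h√r)` for `hr = Dk`.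

No new definition, no new claim; Proposition 14.1 is NOT asserted.

## References

* Y. Zhang, arXiv:2211.02515v1 (2022), §14 (14.8) and u016–u017, p. 79. [cite: Zhang2022LandauSiegel, §14 (14.8) p.79]
* H. L. Montgomery, R. C. Vaughan, *Multiplicative Number Theory I*, CUP 2007, §9.1 (induced
  characters and conductors), Theorem 9.10 (Gauss sum of an induced character). [cite: MontgomeryVaughan2007, §9.1]
-/

noncomputable section

open Complex Real ComplexConjugate

namespace Literature.NumberTheory.LFunctions.Zhang2022.Typed.Sec14

open Skeleton

/-! ## Sizes: `2DP₄ < P` for all large `D` -/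

/-- **`2DP₄ < P` for all large `D`** (`P₄ = PT⁻²t₀`, so this is `2Dt₀ < T²`, i.e.
`2e^{𝓛}𝓛⁵¹⁹ < e^{2𝓛^{1.1}}`): hence `Dk ≤ 2DP₄ < P < p` for `k ≤ 2P₄`, `p ∼ P` — the silent size input of
u017 ("`h < P/r`" for `hr = Dk`). [cite: Zhang2022LandauSiegel, §14 u017 p.79 (`h < P/r`)] -/
theorem exists_two_mul_D_mul_P4_lt_bigP :
    ∃ D₁ : ℕ, ∀ D : ℕ, D₁ ≤ D → 2 * (D : ℝ) * P4 D < bigP D := by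
  have h := (Real.tendsto_exp_div_pow_atTop 519).eventually_ge_atTop 4
  rw [Filter.eventually_atTop] at h
  obtain ⟨x₀, hx₀⟩ := h
  refine ⟨⌈Real.exp (max x₀ 1)⌉₊, fun D hD => ?_⟩
  set L₀ := max x₀ 1 with hL₀
  have hD1 : (1 : ℝ) ≤ D := by
    have h1 : Real.exp L₀ ≤ D := le_trans (Nat.le_ceil _) (by exact_mod_cast hD)
    linarith [Real.add_one_le_exp L₀, le_max_right x₀ 1]
  have hD0 : (0 : ℝ) < D := by linarith
  have hL : L₀ ≤ ell D := by
    rw [ell, Real.le_log_iff_exp_le hD0]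
    exact le_trans (Nat.le_ceil _) (by exact_mod_cast hD)
  have hL1 : 1 ≤ ell D := le_trans (le_max_right _ _) hL
  have hLpos : 0 < ell D := by linarith
  have h1 : 4 ≤ Real.exp (ell D) / ell D ^ 519 := hx₀ (ell D) (le_trans (le_max_left _ _) hL)
  have h2 : 4 * ell D ^ 519 ≤ Real.exp (ell D) := by
    rw [le_div_iff₀ (by positivity)] at h1
    linarith
  have hexpD : Real.exp (ell D) = D := by rw [ell, Real.exp_log hD0]
  have h3 : ell D ≤ ell D ^ (1.1 : ℝ) := by
    calc ell D = ell D ^ (1 : ℝ) := (Real.rpow_one _).symm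
      _ ≤ ell D ^ (1.1 : ℝ) := Real.rpow_le_rpow_of_exponent_le hL1 (by norm_num)
  have hT2 : bigT D ^ 2 = Real.exp (2 * ell D ^ (1.1 : ℝ)) := by
    rw [bigT, ← Real.exp_nat_mul]; norm_num
  have hTpos : 0 < bigT D ^ 2 := pow_pos (Real.exp_pos _) 2
  have hPpos : 0 < bigP D := Real.exp_pos _
  -- `2·D·t₀ < T²`
  have key : 2 * (D : ℝ) * ell D ^ 519 < bigT D ^ 2 := by
    have hpow : 0 < ell D ^ 519 := by positivity
    calc 2 * (D : ℝ) * ell D ^ 519 < 4 * (D : ℝ) * ell D ^ 519 := by nlinarith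
      _ = D * (4 * ell D ^ 519) := by ring
      _ ≤ D * Real.exp (ell D) := by gcongr
      _ = Real.exp (2 * ell D) := by rw [← hexpD, ← Real.exp_add]; ring_nf
      _ ≤ Real.exp (2 * ell D ^ (1.1 : ℝ)) := Real.exp_le_exp.mpr (by linarith)
      _ = bigT D ^ 2 := hT2.symm
  rw [P4, t0]
  calc 2 * (D : ℝ) * (bigP D / bigT D ^ 2 * ell D ^ 519)
        = bigP D * (2 * (D : ℝ) * ell D ^ 519) / bigT D ^ 2 := by ring
    _ < bigP D * bigT D ^ 2 / bigT D ^ 2 := by gcongr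
    _ = bigP D := by rw [mul_div_assoc, div_self hTpos.ne', mul_one]


/-! ## The `(k, r) ↦ (r, h = Dk/r)` re-indexing of the outer sums -/

/-- **"substituting `Dk = hr`"** (p. 79), the outer bookkeeping: for non-negative `g`, summing
`g(r, Dk/r)` over `k ≤ K` and the divisors `r ≥ 2` of `Dk` is at most summing `g(r,h)` over
`2 ≤ r ≤ M` and `1 ≤ h < P/r` with `D/(D,r) ∣ h`, as soon as `DK ≤ M` and `DK < P` — the map
`(k,r) ↦ (r, Dk/r)` is injective and lands in that range (u016 gives the congruence on `h`).
[cite: Zhang2022LandauSiegel, §14 u017 p.79, tex L3956] -/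
theorem sum_divisors_reindex_le (D K M : ℕ) (P : ℝ) (hD : 0 < D) (hM : D * K ≤ M)
    (hP : ((D * K : ℕ) : ℝ) < P) (g : ℕ → ℕ → ℝ) (hg : ∀ r h, 0 ≤ g r h) :
    ∑ k ∈ Finset.Icc 1 K, ∑ r ∈ (D * k).divisors, (if 2 ≤ r then g r (D * k / r) else 0) ≤
      ∑ r ∈ Finset.Icc 2 M,
        ∑ h ∈ (Finset.Ico 1 ⌈P / r⌉₊).filter (fun h => D / Nat.gcd D r ∣ h), g r h := by
  classical
  have step1 : ∀ k ∈ Finset.Icc 1 K,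
      ∑ r ∈ (D * k).divisors, (if 2 ≤ r then g r (D * k / r) else 0) =
        ∑ r ∈ (D * k).divisors.filter (fun r => 2 ≤ r), g r (D * k / r) := by
    intro k _
    rw [Finset.sum_filter]
  rw [Finset.sum_congr rfl step1, Finset.sum_sigma', Finset.sum_sigma']
  set A : Finset (Σ _ : ℕ, ℕ) :=
    (Finset.Icc 1 K).sigma fun k => (D * k).divisors.filter (fun r => 2 ≤ r) with hA
  set T : Finset (Σ _ : ℕ, ℕ) := (Finset.Icc 2 M).sigma fun r =>
    (Finset.Ico 1 ⌈P / r⌉₊).filter (fun h => D / Nat.gcd D r ∣ h) with hT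
  let ψ : (Σ _ : ℕ, ℕ) → (Σ _ : ℕ, ℕ) := fun x => ⟨x.2, D * x.1 / x.2⟩
  -- membership in `A`, unpacked
  have memA : ∀ x ∈ A, 1 ≤ x.1 ∧ x.1 ≤ K ∧ x.2 ∣ D * x.1 ∧ 2 ≤ x.2 := by
    rintro ⟨k, r⟩ hx
    simp only [hA, Finset.mem_sigma, Finset.mem_Icc, Finset.mem_filter, Nat.mem_divisors] at hx
    exact ⟨hx.1.1, hx.1.2, hx.2.1.1, hx.2.2⟩
  have hinj : Set.InjOn ψ A := by
    rintro ⟨k₁, r₁⟩ h₁ ⟨k₂, r₂⟩ h₂ heq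
    obtain ⟨-, -, hr₁, h2₁⟩ := memA _ h₁
    obtain ⟨-, -, hr₂, -⟩ := memA _ h₂
    simp only [ψ, Sigma.mk.inj_iff, heq_eq_eq] at heq
    obtain ⟨hr, hq⟩ := heq
    subst hr
    have hk : D * k₁ = D * k₂ := by
      rw [← Nat.div_mul_cancel hr₁, ← Nat.div_mul_cancel hr₂, hq]
    have : k₁ = k₂ := Nat.eq_of_mul_eq_mul_left hD hk
    subst this
    rfl
  have hsub : A.image ψ ⊆ T := by
    intro y hy
    obtain ⟨x, hx, rfl⟩ := Finset.mem_image.mp hy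
    obtain ⟨hk1, hkK, hr, h2⟩ := memA x hx
    have hr0 : 0 < x.2 := by omega
    have hDk : 0 < D * x.1 := Nat.mul_pos hD (by omega)
    have hrle : x.2 ≤ D * x.1 := Nat.le_of_dvd hDk hr
    have hDkM : D * x.1 ≤ M := le_trans (Nat.mul_le_mul_left D hkK) hM
    simp only [hT, Finset.mem_sigma, Finset.mem_Icc, Finset.mem_filter, Finset.mem_Ico, ψ]
    refine ⟨⟨h2, hrle.trans hDkM⟩, ⟨?_, ?_⟩, step14u016_holds D x.1 x.2 hr⟩
    · exact Nat.div_pos hrle hr0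
    · rw [Nat.lt_ceil, lt_div_iff₀ (by exact_mod_cast hr0)]
      have h1 : ((D * x.1 / x.2 : ℕ) : ℝ) * x.2 = ((D * x.1 : ℕ) : ℝ) := by
        rw [← Nat.cast_mul, Nat.div_mul_cancel hr]
      rw [h1]
      calc ((D * x.1 : ℕ) : ℝ) ≤ ((D * K : ℕ) : ℝ) := by exact_mod_cast Nat.mul_le_mul_left D hkK
        _ < P := hP
  calc ∑ x ∈ A, g x.2 (D * x.1 / x.2)
        = ∑ x ∈ A, (fun y : Σ _ : ℕ, ℕ => g y.1 y.2) (ψ x) := rfl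
    _ = ∑ y ∈ A.image ψ, g y.1 y.2 :=
        (Finset.sum_image (f := fun y : Σ _ : ℕ, ℕ => g y.1 y.2) hinj).symm
    _ ≤ ∑ y ∈ T, g y.1 y.2 :=
        Finset.sum_le_sum_of_subset_of_nonneg hsub fun y _ _ => hg y.1 y.2

/-! ## One term: the induced character `θ = θ* (mod Dk)` against `θ* (mod r)` -/

/-- **`θ(l) = θ*(l)·[(l,h) = 1]` and `θ̄(p) = θ̄*(p)`, `Δ(l/(Dpk)) = Δ(l/(phr))`** for `θ` induced to
the modulus `Dk = hr` by `θ* (mod r)` and `p ∼ P` prime to `Dk`: the `l`-th term of the inner series of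
the left side of (14.8) is the `l`-th term of the u017 series. [cite: Zhang2022LandauSiegel, §14 u017 p.79, tex L3956] -/
theorem changeLevel_term_eq {D : ℕ} [NeZero D] (χ : DirichletCharacter ℂ D) {k r h : ℕ}
    (hhr : h * r = D * k) (hr : r ∣ D * k) (θ : DirichletCharacter ℂ r) (κs : ℕ → ℂ) (d l : ℕ)
    (hcop : ∀ p ∈ primeWindow D, Nat.Coprime p (D * k)) :
    κs (d * l) * DirichletCharacter.changeLevel hr θ (l : ZMod (D * k)) *
        ∑ p ∈ primeWindow D, χ (p : ZMod D) *
          (DirichletCharacter.changeLevel hr θ)⁻¹ (p : ZMod (D * k)) *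
            DeltaW D ((l : ℝ) / ((D : ℝ) * p * k)) =
      if Nat.Coprime l h then κs (d * l) * θ (l : ZMod r) *
        ∑ p ∈ primeWindow D, χ (p : ZMod D) * θ⁻¹ (p : ZMod r) *
          DeltaW D ((l : ℝ) / ((p : ℝ) * h * r)) else 0 := by
  -- the `p`-sums agree
  have hp_eq : ∑ p ∈ primeWindow D, χ (p : ZMod D) *
          (DirichletCharacter.changeLevel hr θ)⁻¹ (p : ZMod (D * k)) *
            DeltaW D ((l : ℝ) / ((D : ℝ) * p * k)) =
        ∑ p ∈ primeWindow D, χ (p : ZMod D) * θ⁻¹ (p : ZMod r) *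
          DeltaW D ((l : ℝ) / ((p : ℝ) * h * r)) := by
    refine Finset.sum_congr rfl fun p hp => ?_
    have hc : IsCoprime (p : ℤ) ((D * k : ℕ) : ℤ) := Nat.isCoprime_iff_coprime.mpr (hcop p hp)
    have e1 := DirichletCharacter.changeLevel_eq_cast_of_dvd' θ⁻¹ hr hc
    push_cast at e1
    rw [← map_inv (DirichletCharacter.changeLevel hr) θ, e1]
    have harg : ((D : ℝ) * p * k) = (p : ℝ) * h * r := by
      have h' : ((h : ℝ) * r) = (D : ℝ) * k := by exact_mod_cast hhr
      calc (D : ℝ) * p * k = p * ((D : ℝ) * k) := by ring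
        _ = p * ((h : ℝ) * r) := by rw [h']
        _ = (p : ℝ) * h * r := by ring
    rw [harg]
  rw [hp_eq]
  by_cases hl : Nat.Coprime l (D * k)
  · -- `(l, Dk) = 1`: `θ(l) = θ*(l)` and `(l, h) = 1`
    have hlh : Nat.Coprime l h := Nat.Coprime.coprime_dvd_right ⟨r, hhr.symm⟩ hl
    rw [if_pos hlh]
    have hc : IsCoprime (l : ℤ) ((D * k : ℕ) : ℤ) := Nat.isCoprime_iff_coprime.mpr hl
    have e2 := DirichletCharacter.changeLevel_eq_cast_of_dvd' θ hr hc
    push_cast at e2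
    rw [e2]
  · -- `(l, Dk) > 1`: `θ(l) = 0`, and the right side vanishes too
    have hz : DirichletCharacter.changeLevel hr θ (l : ZMod (D * k)) = 0 := by
      refine MulChar.map_nonunit _ ?_
      rwa [ZMod.isUnit_iff_coprime]
    rw [hz, mul_zero, zero_mul]
    split_ifs with hlh
    · have hlr : ¬ Nat.Coprime l r := fun hlr => hl (by
        rw [← hhr]; exact Nat.Coprime.mul_right hlh hlr)
      have hz' : θ (l : ZMod r) = 0 := by
        refine MulChar.map_nonunit _ ?_
        rwa [ZMod.isUnit_iff_coprime]
      rw [hz', mul_zero, zero_mul]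
    · rfl

/-! ## One conductor: the characters `θ (mod Dk)` of conductor `r` -/

/-- **u017, one fiber**: for `r ∣ Dk`, the terms of the left side of (14.8) (for fixed `d`, `k`) with
`θ` of conductor exactly `r` are bounded by `√r` times the u017 inner sum at `(r, h = Dk/r)` over the
primitive `θ* (mod r)`, `θ* ≠ χ` — by `θ = θ*` induced (`FactorsThrough`), `|τ(θ̄)| ≤ √r`
(`step14p79_holds`), and `θ ≠ θ_k¹ ⇒ θ* ≠ χ` (conductors); the fiber is empty for `r < 2` (`θ ≠ 1`).
[cite: Zhang2022LandauSiegel, §14 u017 p.79, tex L3950–L3956] -/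
theorem fiber_sum_le {D : ℕ} [NeZero D] (χ : DirichletCharacter ℂ D) (hχ : χ.IsPrimitive)
    {k r : ℕ} (hk : 0 < k) (hr : r ∣ D * k) (κs : ℕ → ℂ) (d : ℕ)
    (hcop : ∀ p ∈ primeWindow D, Nat.Coprime p (D * k)) :
    ∑ θ ∈ (finsetOf {θ : DirichletCharacter ℂ (D * k) | θ ≠ 1 ∧ θ ≠ thetaOne χ k}).filter
        (fun θ => θ.conductor = r),
      ‖tauSum (D * k) θ⁻¹‖ *
        ‖∑' l : ℕ, κs (d * l) * θ (l : ZMod (D * k)) *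
            ∑ p ∈ primeWindow D, χ (p : ZMod D) * θ⁻¹ (p : ZMod (D * k)) *
              DeltaW D ((l : ℝ) / ((D : ℝ) * p * k))‖ ≤
      if 2 ≤ r then Real.sqrt r *
        ∑ θ ∈ finsetOf {θ : DirichletCharacter ℂ r | θ.IsPrimitive ∧
            DirichletCharacter.changeLevel (dvd_mul_left r D) θ ≠
              DirichletCharacter.changeLevel (dvd_mul_right D r) χ},
          ‖∑' l : ℕ, if Nat.Coprime l (D * k / r) then
              κs (d * l) * θ (l : ZMod r) *
                ∑ p ∈ primeWindow D, χ (p : ZMod D) * θ⁻¹ (p : ZMod r) *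
                  DeltaW D ((l : ℝ) / ((p : ℝ) * ↑(D * k / r) * r)) else 0‖
      else 0 := by
  classical
  haveI hDk : NeZero (D * k) := ⟨Nat.mul_ne_zero (NeZero.ne D) hk.ne'⟩
  have hTfin : ({θ : DirichletCharacter ℂ (D * k) | θ ≠ 1 ∧ θ ≠ thetaOne χ k}).Finite :=
    Set.toFinite _
  split_ifs with h2
  · -- `2 ≤ r`
    haveI : NeZero r := ⟨by omega⟩
    have hSfin : ({θ : DirichletCharacter ℂ r | θ.IsPrimitive ∧
        DirichletCharacter.changeLevel (dvd_mul_left r D) θ ≠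
          DirichletCharacter.changeLevel (dvd_mul_right D r) χ}).Finite := Set.toFinite _
    have hhr : D * k / r * r = D * k := Nat.div_mul_cancel hr
    -- the fiber lies in the image of the primitive characters mod `r` under induction
    have hsub : (finsetOf {θ : DirichletCharacter ℂ (D * k) | θ ≠ 1 ∧ θ ≠ thetaOne χ k}).filter
          (fun θ => θ.conductor = r) ⊆
        (finsetOf {θ : DirichletCharacter ℂ r | θ.IsPrimitive ∧
            DirichletCharacter.changeLevel (dvd_mul_left r D) θ ≠
              DirichletCharacter.changeLevel (dvd_mul_right D r) χ}).image
          (DirichletCharacter.changeLevel hr) := by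
      intro θ hθ
      rw [Finset.mem_filter] at hθ
      obtain ⟨hθT, hcond⟩ := hθ
      obtain ⟨hne1, hneχ⟩ := (mem_finsetOf hTfin).mp hθT
      have hft : θ.FactorsThrough r :=
        (DirichletCharacter.mem_conductorSet_iff_conductor_dvd θ hr).mpr (hcond ▸ dvd_rfl)
      obtain ⟨θ₀, hθ₀⟩ : ∃ θ₀ : DirichletCharacter ℂ r,
          θ = DirichletCharacter.changeLevel hr θ₀ := ⟨hft.χ₀, hft.eq_changeLevel⟩
      refine Finset.mem_image.mpr ⟨θ₀, ?_, hθ₀.symm⟩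
      rw [mem_finsetOf hSfin]
      have hprimθ₀ : θ₀.IsPrimitive := by
        rw [DirichletCharacter.isPrimitive_def, ← DirichletCharacter.conductor_changeLevel θ₀ hr,
          ← hθ₀, hcond]
      refine ⟨hprimθ₀, fun heq => hneχ ?_⟩
      have hrD : r = D := by
        have h1 := congrArg DirichletCharacter.conductor heq
        rwa [DirichletCharacter.conductor_changeLevel θ₀, DirichletCharacter.conductor_changeLevel χ,
          hprimθ₀, hχ] at h1
      subst hrD
      have hθχ : θ₀ = χ := DirichletCharacter.changeLevel_injective _ heq
      rw [hθ₀, hθχ, thetaOne]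
    have hinj : Set.InjOn (DirichletCharacter.changeLevel (R := ℂ) hr)
        ↑(finsetOf {θ : DirichletCharacter ℂ r | θ.IsPrimitive ∧
            DirichletCharacter.changeLevel (dvd_mul_left r D) θ ≠
              DirichletCharacter.changeLevel (dvd_mul_right D r) χ}) :=
      fun _ _ _ _ h => DirichletCharacter.changeLevel_injective hr h
    refine le_trans (Finset.sum_le_sum_of_subset_of_nonneg hsub fun θ _ _ =>
      mul_nonneg (norm_nonneg _) (norm_nonneg _)) ?_
    rw [Finset.sum_image hinj, Finset.mul_sum]
    refine Finset.sum_le_sum fun θ₀ hθ₀ => ?_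
    obtain ⟨hprim, -⟩ := (mem_finsetOf hSfin).mp hθ₀
    -- `|τ(θ̄)| ≤ √r`
    have hτ : ‖tauSum (D * k) (DirichletCharacter.changeLevel hr θ₀)⁻¹‖ ≤ Real.sqrt r := by
      have h79 := (step14p79_holds (D * k) (DirichletCharacter.changeLevel hr θ₀) (NeZero.pos _)).2
      rwa [DirichletCharacter.conductor_changeLevel θ₀ hr, hprim] at h79
    -- the series agree termwise
    have hser : (∑' l : ℕ, κs (d * l) * DirichletCharacter.changeLevel hr θ₀ (l : ZMod (D * k)) *
          ∑ p ∈ primeWindow D, χ (p : ZMod D) *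
            (DirichletCharacter.changeLevel hr θ₀)⁻¹ (p : ZMod (D * k)) *
              DeltaW D ((l : ℝ) / ((D : ℝ) * p * k))) =
        ∑' l : ℕ, if Nat.Coprime l (D * k / r) then
          κs (d * l) * θ₀ (l : ZMod r) *
            ∑ p ∈ primeWindow D, χ (p : ZMod D) * θ₀⁻¹ (p : ZMod r) *
              DeltaW D ((l : ℝ) / ((p : ℝ) * ↑(D * k / r) * r)) else 0 :=
      tsum_congr fun l => changeLevel_term_eq χ hhr hr θ₀ κs d l hcop
    rw [hser]
    exact mul_le_mul_of_nonneg_right hτ (norm_nonneg _)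
  · -- `r < 2`: the fiber is empty (`θ ≠ 1` has conductor `≥ 2`)
    have hempty : ∀ θ ∈ (finsetOf {θ : DirichletCharacter ℂ (D * k) | θ ≠ 1 ∧ θ ≠ thetaOne χ k}).filter
        (fun θ => θ.conductor = r), False := by
      intro θ hθ
      rw [Finset.mem_filter] at hθ
      obtain ⟨hθT, hcond⟩ := hθ
      obtain ⟨hne1, -⟩ := (mem_finsetOf hTfin).mp hθT
      have hc0 : θ.conductor ≠ 0 := DirichletCharacter.conductor_ne_zero θ
      have hc1 : θ.conductor ≠ 1 := fun h =>
        hne1 (DirichletCharacter.eq_one_iff_conductor_eq_one.mpr h)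
      omega
    rw [Finset.sum_eq_zero fun θ hθ => (hempty θ hθ).elim]

/-! ## One `k`: all conductors, with the weights `|a*(dk)|/(φ(Dk)k)` against `D/(φ(hr)h√r)` -/

/-- **u017 for one `k`**: splitting the characters `θ (mod Dk)` by conductor `r ∣ Dk`
(`Finset.sum_fiberwise_of_maps_to`) and applying `fiber_sum_le`, the `k`-th term of the left side of
(14.8) (for fixed `d`) is at most `Σ_{r ∣ Dk, r ≥ 2} B·D/(φ(hr)h√r)·(u017 inner sum at (r,h))` with
`h = Dk/r`, because `|a*(dk)|√r/(φ(Dk)k) ≤ B·D/(φ(hr)h√r)` when `hr = Dk`.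
[cite: Zhang2022LandauSiegel, §14 u017 p.79, tex L3950–L3956] -/
theorem term_k_le {D : ℕ} [NeZero D] (χ : DirichletCharacter ℂ D) (hχ : χ.IsPrimitive)
    {B : ℝ} {as : ℕ → ℂ} (has : ∀ n, ‖as n‖ ≤ B) (κs : ℕ → ℂ) (d : ℕ) {k : ℕ} (hk : 0 < k)
    (hcop : ∀ p ∈ primeWindow D, Nat.Coprime p (D * k)) :
    ‖as (d * k)‖ / ((Nat.totient (D * k) : ℝ) * k) *
        ∑ θ ∈ finsetOf {θ : DirichletCharacter ℂ (D * k) | θ ≠ 1 ∧ θ ≠ thetaOne χ k},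
          ‖tauSum (D * k) θ⁻¹‖ *
            ‖∑' l : ℕ, κs (d * l) * θ (l : ZMod (D * k)) *
                ∑ p ∈ primeWindow D, χ (p : ZMod D) * θ⁻¹ (p : ZMod (D * k)) *
                  DeltaW D ((l : ℝ) / ((D : ℝ) * p * k))‖ ≤
      ∑ r ∈ (D * k).divisors, if 2 ≤ r then
        B * ((D : ℝ) / ((Nat.totient (D * k / r * r) : ℝ) * ↑(D * k / r) * Real.sqrt r) *
          ∑ θ ∈ finsetOf {θ : DirichletCharacter ℂ r | θ.IsPrimitive ∧
              DirichletCharacter.changeLevel (dvd_mul_left r D) θ ≠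
                DirichletCharacter.changeLevel (dvd_mul_right D r) χ},
            ‖∑' l : ℕ, if Nat.Coprime l (D * k / r) then
                κs (d * l) * θ (l : ZMod r) *
                  ∑ p ∈ primeWindow D, χ (p : ZMod D) * θ⁻¹ (p : ZMod r) *
                    DeltaW D ((l : ℝ) / ((p : ℝ) * ↑(D * k / r) * r)) else 0‖) else 0 := by
  classical
  haveI hDk : NeZero (D * k) := ⟨Nat.mul_ne_zero (NeZero.ne D) hk.ne'⟩
  have hmaps : ∀ θ ∈ finsetOf {θ : DirichletCharacter ℂ (D * k) | θ ≠ 1 ∧ θ ≠ thetaOne χ k},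
      θ.conductor ∈ (D * k).divisors := fun θ _ =>
    Nat.mem_divisors.mpr ⟨θ.conductor_dvd_level, NeZero.ne _⟩
  rw [← Finset.sum_fiberwise_of_maps_to hmaps, Finset.mul_sum]
  refine Finset.sum_le_sum fun r hr => ?_
  have hrdvd : r ∣ D * k := (Nat.mem_divisors.mp hr).1
  have hfib := fiber_sum_le χ hχ hk hrdvd κs d hcop
  have ha : 0 ≤ ‖as (d * k)‖ / ((Nat.totient (D * k) : ℝ) * k) := by positivity
  refine le_trans (mul_le_mul_of_nonneg_left hfib ha) ?_
  split_ifs with h2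
  · have hr0 : 0 < r := by omega
    have hhr : D * k / r * r = D * k := Nat.div_mul_cancel hrdvd
    have hS : 0 ≤ ∑ θ ∈ finsetOf {θ : DirichletCharacter ℂ r | θ.IsPrimitive ∧
            DirichletCharacter.changeLevel (dvd_mul_left r D) θ ≠
              DirichletCharacter.changeLevel (dvd_mul_right D r) χ},
          ‖∑' l : ℕ, if Nat.Coprime l (D * k / r) then
              κs (d * l) * θ (l : ZMod r) *
                ∑ p ∈ primeWindow D, χ (p : ZMod D) * θ⁻¹ (p : ZMod r) *
                  DeltaW D ((l : ℝ) / ((p : ℝ) * ↑(D * k / r) * r)) else 0‖ :=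
      Finset.sum_nonneg fun _ _ => norm_nonneg _
    have hφ : (0 : ℝ) < Nat.totient (D * k) := by exact_mod_cast Nat.totient_pos.mpr (NeZero.pos _)
    have hk' : (0 : ℝ) < k := by exact_mod_cast hk
    have hr' : (0 : ℝ) < r := by exact_mod_cast hr0
    have hq : ((D * k / r : ℕ) : ℝ) * r = (D : ℝ) * k := by exact_mod_cast hhr
    have hqpos : (0 : ℝ) < (D * k / r : ℕ) := by
      exact_mod_cast Nat.div_pos (Nat.le_of_dvd (NeZero.pos _) hrdvd) hr0
    have hsq : Real.sqrt r * Real.sqrt r = r := Real.mul_self_sqrt (Nat.cast_nonneg r)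
    have hsqpos : 0 < Real.sqrt r := Real.sqrt_pos.mpr hr'
    -- the weight identity `D/(φ(hr)h√r) = √r/(φ(Dk)k)` for `hr = Dk`
    have hid : (D : ℝ) / ((Nat.totient (D * k / r * r) : ℝ) * ↑(D * k / r) * Real.sqrt r) =
        Real.sqrt r / ((Nat.totient (D * k) : ℝ) * k) := by
      rw [hhr, div_eq_div_iff (by positivity) (by positivity)]
      calc (D : ℝ) * ((Nat.totient (D * k) : ℝ) * k)
            = (Nat.totient (D * k) : ℝ) * ((D : ℝ) * k) := by ring
        _ = (Nat.totient (D * k) : ℝ) * (((D * k / r : ℕ) : ℝ) * r) := by rw [hq]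
        _ = (Nat.totient (D * k) : ℝ) * ((D * k / r : ℕ) : ℝ) * (Real.sqrt r * Real.sqrt r) := by
            rw [hsq]; ring
        _ = Real.sqrt r * ((Nat.totient (D * k) : ℝ) * ↑(D * k / r) * Real.sqrt r) := by ring
    have hkey : ‖as (d * k)‖ / ((Nat.totient (D * k) : ℝ) * k) * Real.sqrt r ≤
        B * ((D : ℝ) / ((Nat.totient (D * k / r * r) : ℝ) * ↑(D * k / r) * Real.sqrt r)) := by
      rw [hid]
      calc ‖as (d * k)‖ / ((Nat.totient (D * k) : ℝ) * k) * Real.sqrt r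
            = ‖as (d * k)‖ * (Real.sqrt r / ((Nat.totient (D * k) : ℝ) * k)) := by ring
        _ ≤ B * (Real.sqrt r / ((Nat.totient (D * k) : ℝ) * k)) :=
            mul_le_mul_of_nonneg_right (has _) (by positivity)
    calc ‖as (d * k)‖ / ((Nat.totient (D * k) : ℝ) * k) * (Real.sqrt r * _)
          = (‖as (d * k)‖ / ((Nat.totient (D * k) : ℝ) * k) * Real.sqrt r) * _ := by ring
      _ ≤ (B * ((D : ℝ) / ((Nat.totient (D * k / r * r) : ℝ) * ↑(D * k / r) * Real.sqrt r))) * _ :=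
          mul_le_mul_of_nonneg_right hkey hS
      _ = _ := by ring
  · simp

/-! ## The re-indexing of record: u017 on the closed conductor range `1 < r ≤ 2DP₄` -/

/-- **§14 u017, kernel-checked on the closed conductor range** (Z22 p.79, tex L3950–L3956): for every
implied constant `B` of (14.1)–(14.2) and all large `D` (every real primitive `χ (mod D)`, every
`𝐤*, 𝐚*` subject to (14.1)–(14.2)),
`lhs148 ≤ B · Σ_d d⁻¹ Σ_{1<r≤2DP₄} Σ_{h<P/r, D/(D,r)∣h} D/(φ(hr)h√r) Σ*_{θ≠χ} |Σ_{(l,h)=1} κ*(dl)θ(l)Σ_{p∼P}χθ̄(p)Δ(l/(phr))|`,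
i.e. the left side of (14.8) (`Typed.Sec14.lhs148`) is at most `B` times the u017 majorant
`Typed.Sec14.rhs1417On` on the range `Finset.Icc 2 ⌊2DP₄⌋₊` (the printed `1 < r < 2DP₄` closed at the
right end; see the module docstring for why the end point is kept). Assumption (A) is not used.
[cite: Zhang2022LandauSiegel, §14 u017 p.79, tex L3950–L3956] -/
theorem lhs148_le_rhs1417On_closed (B : ℝ) :
    ForAllLarge fun D _ χ => ∀ κs as : ℕ → ℂ, Eq141 B κs → Eq142 D B as →
      lhs148 χ κs as ≤ B * rhs1417On χ κs (Finset.Icc 2 ⌊2 * (D : ℝ) * P4 D⌋₊) := by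
  classical
  obtain ⟨D₁, hD₁⟩ := exists_two_mul_D_mul_P4_lt_bigP
  refine ⟨D₁, fun D _ χ hD _ hprim κs as _ h142 => ?_⟩
  have hB : 0 ≤ B := (norm_nonneg _).trans (h142.1 0)
  have hD0 : 0 < D := NeZero.pos D
  have hDP : 2 * (D : ℝ) * P4 D < bigP D := hD₁ D hD
  have hP4 : 0 ≤ P4 D := by
    rw [P4, t0]
    exact mul_nonneg (div_nonneg (Real.exp_pos _).le (pow_nonneg (Real.exp_pos _).le 2))
      (pow_nonneg (Real.log_natCast_nonneg D) 519)
  -- `D⌊2P₄⌋ ≤ ⌊2DP₄⌋` and `D⌊2P₄⌋ < P`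
  have hDK : ((D * ⌊2 * P4 D⌋₊ : ℕ) : ℝ) ≤ 2 * (D : ℝ) * P4 D := by
    push_cast
    have := Nat.floor_le (show 0 ≤ 2 * P4 D by linarith)
    nlinarith [Nat.cast_nonneg (α := ℝ) D]
  have hKM : D * ⌊2 * P4 D⌋₊ ≤ ⌊2 * (D : ℝ) * P4 D⌋₊ := Nat.le_floor hDK
  have hKP : ((D * ⌊2 * P4 D⌋₊ : ℕ) : ℝ) < bigP D := hDK.trans_lt hDP
  -- every `p ∼ P` is prime to `Dk` for `k ≤ 2P₄` (`p > P > 2DP₄ ≥ Dk`)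
  have hcop : ∀ k ∈ Finset.Icc 1 ⌊2 * P4 D⌋₊, ∀ p ∈ primeWindow D, Nat.Coprime p (D * k) := by
    intro k hk p hp
    have hprime : p.Prime := (Finset.mem_filter.mp hp).2
    have hPp : bigP D < p :=
      (Nat.floor_lt (Real.exp_pos _).le).mp (Finset.mem_Ioo.mp (Finset.mem_filter.mp hp).1).1
    obtain ⟨hk1, hk2⟩ := Finset.mem_Icc.mp hk
    have hDk : D * k < p := by
      have h1 : ((D * k : ℕ) : ℝ) ≤ ((D * ⌊2 * P4 D⌋₊ : ℕ) : ℝ) := by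
        exact_mod_cast Nat.mul_le_mul_left D hk2
      exact_mod_cast (h1.trans_lt hKP).trans hPp
    have hDk0 : 0 < D * k := Nat.mul_pos hD0 hk1
    exact (Nat.Prime.coprime_iff_not_dvd hprime).mpr fun h =>
      absurd (Nat.le_of_dvd hDk0 h) (not_le.mpr hDk)
  unfold lhs148 rhs1417On
  rw [Finset.mul_sum]
  refine Finset.sum_le_sum fun d _ => ?_
  rw [mul_left_comm]
  refine mul_le_mul_of_nonneg_left ?_ (inv_nonneg.mpr (Nat.cast_nonneg d))
  -- for this `d`: bound each `k`-term by the conductor split, then re-index `(k, r) ↦ (r, Dk/r)`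
  refine le_trans (Finset.sum_le_sum fun k hk =>
    term_k_le χ hprim h142.1 κs d (Finset.mem_Icc.mp hk).1 (hcop k hk)) ?_
  -- the u017 summand as a function of `(r, h)`
  set g : ℕ → ℕ → ℝ := fun r h => (D : ℝ) / ((Nat.totient (h * r) : ℝ) * h * Real.sqrt r) *
      ∑ θ ∈ finsetOf {θ : DirichletCharacter ℂ r | θ.IsPrimitive ∧
          DirichletCharacter.changeLevel (dvd_mul_left r D) θ ≠
            DirichletCharacter.changeLevel (dvd_mul_right D r) χ},
        ‖∑' l : ℕ, if Nat.Coprime l h then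
            κs (d * l) * θ (l : ZMod r) *
              ∑ p ∈ primeWindow D, χ (p : ZMod D) * θ⁻¹ (p : ZMod r) *
                DeltaW D ((l : ℝ) / ((p : ℝ) * h * r)) else 0‖ with hg_def
  have hg_nonneg : ∀ r h, 0 ≤ g r h := fun r h =>
    mul_nonneg (div_nonneg (Nat.cast_nonneg D)
      (mul_nonneg (mul_nonneg (Nat.cast_nonneg _) (Nat.cast_nonneg h)) (Real.sqrt_nonneg r)))
      (Finset.sum_nonneg fun _ _ => norm_nonneg _)
  have hpull : ∀ k ∈ Finset.Icc 1 ⌊2 * P4 D⌋₊,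
      (∑ r ∈ (D * k).divisors, if 2 ≤ r then
        B * ((D : ℝ) / ((Nat.totient (D * k / r * r) : ℝ) * ↑(D * k / r) * Real.sqrt r) *
          ∑ θ ∈ finsetOf {θ : DirichletCharacter ℂ r | θ.IsPrimitive ∧
              DirichletCharacter.changeLevel (dvd_mul_left r D) θ ≠
                DirichletCharacter.changeLevel (dvd_mul_right D r) χ},
            ‖∑' l : ℕ, if Nat.Coprime l (D * k / r) then
                κs (d * l) * θ (l : ZMod r) *
                  ∑ p ∈ primeWindow D, χ (p : ZMod D) * θ⁻¹ (p : ZMod r) *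
                    DeltaW D ((l : ℝ) / ((p : ℝ) * ↑(D * k / r) * r)) else 0‖) else 0) =
      B * ∑ r ∈ (D * k).divisors, if 2 ≤ r then g r (D * k / r) else 0 := by
    intro k _
    rw [Finset.mul_sum]
    refine Finset.sum_congr rfl fun r _ => ?_
    split_ifs
    · simp only [hg_def]
    · simp
  rw [Finset.sum_congr rfl hpull, ← Finset.mul_sum]
  refine mul_le_mul_of_nonneg_left ?_ hB
  have hfin := sum_divisors_reindex_le D ⌊2 * P4 D⌋₊ ⌊2 * (D : ℝ) * P4 D⌋₊ (bigP D) hD0 hKM hKP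
    g hg_nonneg
  calc _ ≤ _ := hfin
    _ = _ := by simp only [hg_def]

/-- **§14 u017 in the shape of `Typed.Sec14.Step14u017`, closed conductor range**: for every `B` there
is `C` (namely `C = B`) with `lhs148 ≤ C · rhs1417On χ 𝐤* [2, ⌊2DP₄⌋]` for all large `D` under (A) and
(14.1)–(14.2) — word for word `Typed.Sec14.Step14u017` except that the u017 majorant is taken on
`1 < r ≤ 2DP₄` instead of `1 < r < 2DP₄` (module docstring). [cite: Zhang2022LandauSiegel, §14 u017 p.79, tex L3956] -/
theorem step14u017_closed : ∀ B : ℝ, ∃ C : ℝ, ForAllLarge fun D _ χ => AssumptionA D χ →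
    ∀ κs as : ℕ → ℂ, Eq141 B κs → Eq142 D B as →
      lhs148 χ κs as ≤ C * rhs1417On χ κs (Finset.Icc 2 ⌊2 * (D : ℝ) * P4 D⌋₊) := by
  intro B
  obtain ⟨D₀, h⟩ := lhs148_le_rhs1417On_closed B
  exact ⟨B, D₀, fun D _ χ hD hq hp _ κs as h141 h142 => h D χ hD hq hp κs as h141 h142⟩

/-! ## The consumer edge: (14.8) from the two `r`-range estimates, closed range -/

/-- The u017 majorant is monotone in the `r`-range (all terms are non-negative).
[cite: Zhang2022LandauSiegel, §14 u017 p.79] -/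
theorem rhs1417On_mono {D : ℕ} (χ : DirichletCharacter ℂ D) (κs : ℕ → ℂ) {S T : Finset ℕ}
    (hST : S ⊆ T) :
    rhs1417On χ κs S ≤ rhs1417On χ κs T := by
  unfold rhs1417On
  refine Finset.sum_le_sum fun d _ => mul_le_mul_of_nonneg_left ?_ (inv_nonneg.mpr (Nat.cast_nonneg d))
  refine Finset.sum_le_sum_of_subset_of_nonneg hST fun r _ _ => Finset.sum_nonneg fun h _ => ?_
  refine mul_nonneg ?_ (Finset.sum_nonneg fun θ _ => norm_nonneg _)
  exact div_nonneg (Nat.cast_nonneg D)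
    (mul_nonneg (mul_nonneg (Nat.cast_nonneg _) (Nat.cast_nonneg h)) (Real.sqrt_nonneg r))

/-- The u017 majorant splits over any partition of the `r`-range by a predicate.
[cite: Zhang2022LandauSiegel, §14 u017 p.79, tex L3960] -/
theorem rhs1417On_filter_add {D : ℕ} (χ : DirichletCharacter ℂ D) (κs : ℕ → ℂ) (S : Finset ℕ)
    (q : ℕ → Prop) [DecidablePred q] :
    rhs1417On χ κs S = rhs1417On χ κs (S.filter q) + rhs1417On χ κs (S.filter fun r => ¬ q r) := by
  rw [rhs1417On, rhs1417On, rhs1417On, ← Finset.sum_add_distrib]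
  refine Finset.sum_congr rfl fun d _ => ?_
  rw [← mul_add, Finset.sum_filter_add_sum_filter_not]

/-- **`D³ ≤ 2DP₄` for all large `D`** (`2DP₄ = 2De^{𝓛⁹ − 2𝓛^{1.1}}𝓛⁵¹⁹ ≥ 2De^{2𝓛} = 2D³` once
`𝓛 ≥ 2`): the first `r`-range `1 < r < D³` of p. 79 lies inside `1 < r < 2DP₄`.
[cite: Zhang2022LandauSiegel, §14 (14.8) (proof) p.79, tex L3960] -/
theorem exists_pow_three_le_two_mul_D_mul_P4 :
    ∃ D₂ : ℕ, ∀ D : ℕ, D₂ ≤ D → ((D ^ 3 : ℕ) : ℝ) ≤ 2 * (D : ℝ) * P4 D := by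
  refine ⟨⌈Real.exp 2⌉₊, fun D hD => ?_⟩
  have hD2 : Real.exp 2 ≤ D := le_trans (Nat.le_ceil _) (by exact_mod_cast hD)
  have hD0 : (0 : ℝ) < D := lt_of_lt_of_le (Real.exp_pos 2) hD2
  have hL2 : 2 ≤ ell D := by
    rw [ell, Real.le_log_iff_exp_le hD0]; exact hD2
  have hL1 : 1 ≤ ell D := by linarith
  have hexpD : Real.exp (ell D) = D := by rw [ell, Real.exp_log hD0]
  -- `t₀ ≥ 1`, `T² = e^{2𝓛^{1.1}} ≤ e^{2𝓛²}`, `𝓛⁹ − 2𝓛² ≥ 2𝓛`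
  have ht0 : 1 ≤ t0 D := by rw [t0]; exact one_le_pow₀ hL1
  have h11 : ell D ^ (1.1 : ℝ) ≤ ell D ^ 2 := by
    calc ell D ^ (1.1 : ℝ) ≤ ell D ^ (2 : ℝ) := Real.rpow_le_rpow_of_exponent_le hL1 (by norm_num)
      _ = ell D ^ 2 := by norm_cast
  have hT2 : bigT D ^ 2 = Real.exp (2 * ell D ^ (1.1 : ℝ)) := by
    rw [bigT, ← Real.exp_nat_mul]; norm_num
  have h7 : (2 : ℝ) ^ 7 ≤ ell D ^ 7 := pow_le_pow_left₀ (by norm_num) hL2 7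
  have hpoly : 2 * ell D ≤ ell D ^ 9 - 2 * ell D ^ 2 := by
    have hsq : ell D ≤ ell D ^ 2 := by nlinarith
    have h9 : ell D ^ 9 = ell D ^ 2 * ell D ^ 7 := by ring
    nlinarith [sq_nonneg (ell D)]
  have hmain : (D : ℝ) ^ 2 ≤ P4 D := by
    rw [P4, hT2, bigP, ← Real.exp_sub]
    calc (D : ℝ) ^ 2 = Real.exp (2 * ell D) := by rw [← hexpD, ← Real.exp_nat_mul]; norm_num
      _ ≤ Real.exp (ell D ^ 9 - 2 * ell D ^ (1.1 : ℝ)) := Real.exp_le_exp.mpr (by linarith)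
      _ = Real.exp (ell D ^ 9 - 2 * ell D ^ (1.1 : ℝ)) * 1 := (mul_one _).symm
      _ ≤ Real.exp (ell D ^ 9 - 2 * ell D ^ (1.1 : ℝ)) * t0 D := by gcongr
  have hD1 : (1 : ℝ) ≤ D := by linarith [Real.add_one_le_exp (2 : ℝ)]
  push_cast
  nlinarith

/-- **(14.8) ⇐ the two `r`-range estimates, closed range** — the consumer edge of record for the
re-indexing `lhs148_le_rhs1417On_closed`: (14.8) (`Typed.Sec14.Eq148`: `lhs148 ≪ P²D^{−c}`) follows from
"for `1 < r < D³` … Lemma 5.4 (i) and Lemma 5.6" as typed (`Typed.Sec14.Eq148leg1`) together with the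
second-range estimate "for `D³ ≤ r < 2DP₄` … the large sieve inequality" taken on the CLOSED range
`D³ ≤ r ≤ 2DP₄` (stated inline: the `r`-range `Finset.Icc 2 ⌊2DP₄⌋₊` filtered by `¬ r < D³`), with
`c = min(c₁,c₂)`, `C = |B|(|C₁| + |C₂|)`; the first range needs no change because `D³ ≤ 2DP₄`
(`exists_pow_three_le_two_mul_D_mul_P4`). So the open-range u017 (`Typed.Sec14.Step14u017`) is not
needed by any consumer. [cite: Zhang2022LandauSiegel, §14 (14.8) (proof) p.79, tex L3956–L3963] -/
theorem eq148_of_legs_closed (h1 : Eq148leg1)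
    (h2 : ∀ B : ℝ, ∃ c : ℝ, 0 < c ∧ ∃ C : ℝ, ForAllLarge fun D _ χ => AssumptionA D χ →
      ∀ κs as : ℕ → ℂ, Eq141 B κs → Eq142 D B as →
        rhs1417On χ κs ((Finset.Icc 2 ⌊2 * (D : ℝ) * P4 D⌋₊).filter (fun r => ¬ r < D ^ 3))
          ≤ C * bigP D ^ 2 * (D : ℝ) ^ (-c)) :
    Eq148 := by
  intro B
  obtain ⟨c₁, hc₁, C₁, h1⟩ := h1 B
  obtain ⟨c₂, hc₂, C₂, h2⟩ := h2 B
  have h0 := lhs148_le_rhs1417On_closed B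
  obtain ⟨D₂, hD₂⟩ := exists_pow_three_le_two_mul_D_mul_P4
  refine ⟨min c₁ c₂, lt_min hc₁ hc₂, |B| * (|C₁| + |C₂|), ?_⟩
  obtain ⟨D₀, hD₀⟩ := (h0.and h1).and h2
  refine ⟨max D₀ (max D₂ 1), fun D _ χ hD hq hp hA κs as hκ ha => ?_⟩
  have hD₀' : D₀ ≤ D := le_trans (le_max_left _ _) hD
  have hD₂' : D₂ ≤ D := le_trans (le_trans (le_max_left _ _) (le_max_right _ _)) hD
  have hD1 : (1 : ℝ) ≤ D := by
    exact_mod_cast le_trans (le_trans (le_max_right _ _) (le_max_right _ _)) hD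
  obtain ⟨⟨e0, e1⟩, e2⟩ := hD₀ D χ hD₀' hq hp
  have g0 := e0 κs as hκ ha
  have g1 := e1 hA κs as hκ ha
  have g2 := e2 hA κs as hκ ha
  set M := ⌊2 * (D : ℝ) * P4 D⌋₊ with hM
  -- split the closed range at `D³`; the first part sits inside the typed first range
  have hsplit := rhs1417On_filter_add χ κs (Finset.Icc 2 M) (fun r => r < D ^ 3)
  have hsub : (Finset.Icc 2 M).filter (fun r => r < D ^ 3) ⊆
      (Finset.Ico 2 ⌈2 * (D : ℝ) * P4 D⌉₊).filter (fun r => r < D ^ 3) := by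
    intro r hr
    simp only [Finset.mem_filter, Finset.mem_Icc, Finset.mem_Ico] at hr ⊢
    refine ⟨⟨hr.1.1, ?_⟩, hr.2⟩
    rw [Nat.lt_ceil]
    calc (r : ℝ) < ((D ^ 3 : ℕ) : ℝ) := by exact_mod_cast hr.2
      _ ≤ 2 * (D : ℝ) * P4 D := hD₂ D hD₂'
  set L₁ := rhs1417On χ κs ((Finset.Ico 2 ⌈2 * (D : ℝ) * P4 D⌉₊).filter (fun r => r < D ^ 3))
  set L₁' := rhs1417On χ κs ((Finset.Icc 2 M).filter (fun r => r < D ^ 3))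
  set L₂ := rhs1417On χ κs ((Finset.Icc 2 M).filter (fun r => ¬ r < D ^ 3))
  have hmono : L₁' ≤ L₁ := rhs1417On_mono χ κs hsub
  have hL₁ : 0 ≤ L₁ := rhs1417On_nonneg χ κs _
  have hL₂ : 0 ≤ L₂ := rhs1417On_nonneg χ κs _
  have hP : 0 ≤ bigP D ^ 2 := sq_nonneg _
  have hpow₁ : (D : ℝ) ^ (-c₁) ≤ (D : ℝ) ^ (-min c₁ c₂) :=
    Real.rpow_le_rpow_of_exponent_le hD1 (neg_le_neg (min_le_left c₁ c₂))
  have hpow₂ : (D : ℝ) ^ (-c₂) ≤ (D : ℝ) ^ (-min c₁ c₂) :=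
    Real.rpow_le_rpow_of_exponent_le hD1 (neg_le_neg (min_le_right c₁ c₂))
  have k1 : L₁ ≤ |C₁| * bigP D ^ 2 * (D : ℝ) ^ (-min c₁ c₂) :=
    calc L₁ ≤ C₁ * bigP D ^ 2 * (D : ℝ) ^ (-c₁) := g1
      _ ≤ |C₁| * bigP D ^ 2 * (D : ℝ) ^ (-c₁) := by
          gcongr
          exact le_abs_self C₁
      _ ≤ |C₁| * bigP D ^ 2 * (D : ℝ) ^ (-min c₁ c₂) := by gcongr
  have k2 : L₂ ≤ |C₂| * bigP D ^ 2 * (D : ℝ) ^ (-min c₁ c₂) :=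
    calc L₂ ≤ C₂ * bigP D ^ 2 * (D : ℝ) ^ (-c₂) := g2
      _ ≤ |C₂| * bigP D ^ 2 * (D : ℝ) ^ (-c₂) := by
          gcongr
          exact le_abs_self C₂
      _ ≤ |C₂| * bigP D ^ 2 * (D : ℝ) ^ (-min c₁ c₂) := by gcongr
  calc lhs148 χ κs as ≤ B * rhs1417On χ κs (Finset.Icc 2 M) := g0
    _ = B * (L₁' + L₂) := by rw [hsplit]
    _ ≤ |B| * (L₁' + L₂) :=
        mul_le_mul_of_nonneg_right (le_abs_self B) (add_nonneg (rhs1417On_nonneg χ κs _) hL₂)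
    _ ≤ |B| * (L₁ + L₂) := by gcongr
    _ ≤ |B| * (|C₁| * bigP D ^ 2 * (D : ℝ) ^ (-min c₁ c₂) +
          |C₂| * bigP D ^ 2 * (D : ℝ) ^ (-min c₁ c₂)) :=
        mul_le_mul_of_nonneg_left (add_le_add k1 k2) (abs_nonneg B)
    _ = |B| * (|C₁| + |C₂|) * bigP D ^ 2 * (D : ℝ) ^ (-min c₁ c₂) := by ring

end Literature.NumberTheory.LFunctions.Zhang2022.Typed.Sec14
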